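import Summits.NavierStokesRegularity.NavierStokesRegularity.Theorems.FilamentSkeletonRssDefectColumnGateDefsR

/-!
# Route `FilamentSkeletonRss` · NEGATIVE-side support item `NoExactProfileNearSymmetricPair` (stmt-NavierStokesRegularity-24091, B2′-sym, route rev 66) —
# the REFUTATION GLUE: B2′-sym + an inhabited symmetric-pair Γ-family ⇒ ¬ `TransverseReduction1AR` (stmt-23611)

Helper file (theorems only), `--supports stmt-NavierStokesRegularity-24091 --as helper`; LEAD of 23611 / registrar of 23920, lane ns-filament-21221-p1 g14 (draft texts:
crux-dir `Lines/defect_column_gate_1AR_B2sym_DRAFT.lean`; item text typed by tenure g28, stamped by idea-crit-7 g6 04:37:47Z).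

`not_transverseReduction1AR_of_noExactProfileNearSymmetricPair`: if B2′-sym holds and, for SOME box constants, admissible clause-13-R R_π-symmetric thin pairs exist for
all large Γ (the ∃-side's datum as a Γ-family — stated INLINE as a hypothesis, no new definition), then the ∀-crux `TransverseReduction1AR` is FALSE.  Pure logic: 23611 gives
a profile at tolerance `η` (B2′-sym's witness) near the inhabited skeleton; B2′-sym (whose hypotheses are the FLAT sub-block, clauses 0–12 + cores + cone, of `Clauses1R`) forbids it.
HONEST FRAMING: a CONDITIONAL refutation (audit class `refutes.conditional`); neither hypothesis is proved here; 23611/24091/23610 OPEN; nothing here bears on Navier–Stokes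
regularity, which is NOT proved.
-/

set_option linter.dupNamespace false

noncomputable section

namespace Summit.NavierStokesRegularity.NavierStokesRegularity.Theorems.DefectColumnGate

open scoped BigOperators Topology InnerProductSpace
open Filter Set Function
open Literature.Analysis.FluidPDE
open Summit.NavierStokesRegularity.NavierStokesRegularity.Theses.FilamentSkeletonRss

/-- **B2′-sym + inhabitation ⇒ ¬ TransverseReduction1AR.**  The inhabitation hypothesis is the existence, for some box constants and all large `Γ`, of data
`(γ, α, X, w, c, m, n, Aa, u, v, A, T)` satisfying `DefU1, DefV1, DefA1, DefT1, Clauses1R 2 …` (23611's hypothesis block VERBATIM) together with the R_π-symmetry clause of 24091. -/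
theorem not_transverseReduction1AR_of_noExactProfileNearSymmetricPair (hB : NoExactProfileNearSymmetricPair)
    (hE : ∃ (δ ρ K Λ a b cnd Rw Rb cg θ₀ KA : ℝ), 0 < δ ∧ 0 < ρ ∧ 0 ≤ a ∧ 0 < Rw ∧ 0 < Rb ∧ 0 < cg ∧ 0 < θ₀ ∧
      ∃ Γ₀ : ℝ, ∀ Γ : ℝ, Γ₀ ≤ Γ →
      ∃ (γ : Fin 2 → ℝ) (α : ℝ) (X : Fin 2 → ℝ → EuclideanSpace ℝ (Fin 3)) (w : Fin 2 → ℝ → ℝ) (c : Fin 2 → ℝ) (m n : Fin 2 → EuclideanSpace ℝ (Fin 3))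
        (Aa : Fin 2 → ℝ → ℝ) (u : (Fin 2 → ℝ → EuclideanSpace ℝ (Fin 3)) → EuclideanSpace ℝ (Fin 3) → EuclideanSpace ℝ (Fin 3))
        (v : EuclideanSpace ℝ (Fin 3) → EuclideanSpace ℝ (Fin 3)) (A : Fin 2 → (EuclideanSpace ℝ (Fin 3) →L[ℝ] EuclideanSpace ℝ (Fin 3)))
        (T : (Fin 2 → ℝ → EuclideanSpace ℝ (Fin 3)) → Fin 2 → ℝ → EuclideanSpace ℝ (Fin 3)),
        DefU1 2 Γ γ Aa u ∧ DefV1 2 α X u v ∧ DefA1 2 X c v A ∧ DefT1 2 α u T ∧ Clauses1R 2 Γ δ ρ K Λ a b cnd Rw Rb cg θ₀ KA γ α X w c m n Aa v A T ∧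
        (γ 1 = γ 0 ∧ c 1 = c 0 ∧ (∀ τ, X 1 τ = (2 * ⟪X 0 τ, EuclideanSpace.single 2 1⟫_ℝ) • EuclideanSpace.single 2 1 - X 0 τ) ∧
          (∀ τ, w 1 τ = w 0 τ) ∧ (∀ τ, Aa 1 τ = Aa 0 τ))) :
    ¬ TransverseReduction1AR := by
  intro hTR
  obtain ⟨δ, ρ, K, Λ, a, b, cnd, Rw, Rb, cg, θ₀, KA, hδ, hρ, ha, hRw, hRb, hcg, hθ₀, Γ₀, hex⟩ := hE
  obtain ⟨η, hη, Γ₂, hB'⟩ := hB δ ρ K Λ Rw Rb cg θ₀ KA hδ hρ hRw hRb hcg hθ₀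
  obtain ⟨Γ₁, hTR'⟩ := (transverseReduction1AR_iff.mp hTR) 2 δ ρ K Λ a b cnd η Rw Rb cg θ₀ KA (by norm_num) hδ hρ ha hη hRw hRb hcg hθ₀
  obtain ⟨γ, α, X, w, c, m, n, Aa, u, v, A, T, hu, hv, hA, hT, hcl, hsym⟩ := hex (max Γ₀ (max Γ₁ Γ₂)) (le_max_left _ _)
  have h1 : Γ₁ ≤ max Γ₀ (max Γ₁ Γ₂) := le_trans (le_max_left _ _) (le_max_right _ _)
  have h2 : Γ₂ ≤ max Γ₀ (max Γ₁ Γ₂) := le_trans (le_max_right _ _) (le_max_right _ _)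
  -- 23611 delivers a profile at tolerance `η`
  have hprof := hTR' _ h1 γ α X w c m n Aa u v A T hu hv hA hT hcl
  -- B2′-sym needs only the flat sub-block (clauses 0–12 + cores + cone) of `Clauses1R`
  obtain ⟨k1, k2, k3, k4, k5, k6, k7, k8, k9, k10, k11, k12, k13, k14, -, -⟩ := hcl
  exact hB' _ h2 γ α X w c Aa u v hu hv ⟨k1, k2, k3, k4, k5, k6, k7, k8, k9, k10, k11, k12, k13, k14⟩ hsym hprof

end Summit.NavierStokesRegularity.NavierStokesRegularity.Theorems.DefectColumnGate

end
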